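import Mathlib
import Summits.NavierStokesRegularity.NavierStokesRegularity.Theorems.SubcriticalEnvelopeForwardSourceTailEnvelopeKPDyadicRatioTwo
import Summits.NavierStokesRegularity.NavierStokesRegularity.Theorems.SubOnsagerCeilingForwardTailCeilingKPDyadicRange
import HarnessLib

/-!
# `SubcriticalEnvelope.ForwardSourceTailEnvelopeKP` (stmt-NavierStokesRegularity-27130) — the BC5
RUNG extended: the crux's per-table clause HOLDS on the scaled one-mode dyadic tables at EVERY scale
ratio `1 + ε₀ ∈ [17/10, 2]` (helper file, `--supports`; LEAD SOC's rung transported via SE's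
«via-ceiling» reduction)

The sibling file `SubcriticalEnvelopeForwardSourceTailEnvelopeKPDyadicRatioTwo` (LEAD SE) proves the
clause of `ForwardSourceTailEnvelopeKP` after its binders `R, εs, ε₀` for `ε₀ = 1` and
`α = c·dyadicTable` from the rung `stub_dyadicRatioTwo` (Barbato–Morandin–Romito 2011 at `λ = 2`).
Here the same clause is obtained for every `ε₀ ∈ [7/10, 1]` from the LEAD SOC's rung
`dyadicRange_shellBarrierAt` (re-tuned BMR region valid for all `b ∈ [17/10, 2]`, files
`SubOnsagerCeilingDyadicRange{RegionIneq,Region,Chain}` and `…ForwardTailCeilingKPDyadicRange`):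
shell barrier ⇒ ceiling (`subOnsagerCeiling_ceilingAt_of_shellBarrierAt`) ⇒ window envelope
(`viscousTailEnvelopeOrthant_uniform_of_ceilingAt`), `S = univ`, `η = 2θ − 1 = 1/100`, one constant
`C·E₀` uniform in `T` and `ν`.

HONEST FRAMING: MODEL lattice statement (route SubcriticalEnvelope, rung TL-M2Break, one-mode chain
class at large scale ratio); the crux 27130 is NOT proved; nothing bears on Navier–Stokes regularity.
[cite: BarbatoMorandinRomito2011, §2 Lemma 2.1, §3.2] [cite: Tao2016AveragedNS, §4 (4.5), (4.13)]
-/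

noncomputable section

-- the sub-problem namespace `NavierStokesRegularity.NavierStokesRegularity` is the tree's layout (D-0017)
set_option linter.dupNamespace false

namespace Summit.NavierStokesRegularity.NavierStokesRegularity.Theorems

open Set Filter
open scoped Topology
open Literature.Analysis.FluidPDE.TaoCascade
open Summit.NavierStokesRegularity.NavierStokesRegularity.Theorems.SubOnsagerCeiling

/-- **RUNG of 27130 at every scale ratio `1+ε₀ ∈ [17/10, 2]`: the KP forward-source envelope clause
HOLDS on the scaled dyadic tables.** For every spread `R ≥ 1`, every `ε₀ ∈ [7/10, 1]` and every
`α = c·dyadicTable` (`c > 0`) the clause of `ForwardSourceTailEnvelopeKP` after its binders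
`R, εs, ε₀` holds with `S = univ`, `η = 2θ − 1 > 0` (`θ = 101/200`) and, on every window, ONE
constant `C·Σ_j ½X₀_j²` uniform in `T` and in `ν > 0`. The orthant and diagonal-feed binders are
hypotheses (both hold for the chain). MODEL lattice statement; the crux is NOT proved. [this file] -/
theorem forwardSourceTailEnvelopeKP_at_dyadicRange :
    ∀ R : ℝ, 1 ≤ R → ∀ ε₀ : ℝ, 7 / 10 ≤ ε₀ → ε₀ ≤ 1 →
      ∀ α : Fin 4 → Fin 4 → Fin 4 → ℤ × ℤ × ℤ → ℝ, IsScaledDyadic α →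
      InTableClass R α →
      (∀ (Y : Fin 4 → ℤ → ℝ → ℝ) (τ : ℝ), (∀ (j : Fin 4) (k : ℤ), 1 ≤ k → 0 ≤ Y j k τ) →
        ∀ δ : ℝ, 0 < δ → ∀ (i : Fin 4) (n : ℤ), 1 ≤ n → Y i n τ = 0 → 0 ≤ quadTerm δ α Y i n τ) →
      (∀ a b i : Fin 4, a ≠ b → α a b i (0, 0, 1) = 0) →
      ∃ S : Finset (Fin 4), (∀ i, i ∉ S → ∀ j l : Fin 4, α i j l (0, 0, 1) = 0) ∧
      ∀ X₀ : Fin 4 → ℝ, ∃ η : ℝ, 0 < η ∧ ∀ T : ℝ, 0 < T → ∃ C : ℝ, ∀ ν : ℝ, 0 < ν →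
      ∀ s ∈ Set.Ioc (0 : ℝ) T, ∀ X : Fin 4 → ℤ → ℝ → ℝ,
      (∀ i k, X i k 0 = if k = 0 then X₀ i else 0) →
      (∀ i k, k < 0 → ∀ t, X i k t = 0) →
      (∃ M : ℝ, ∀ (t : ℝ) (i : Fin 4) (k : ℤ), (1 + (1 + ε₀) ^ ((10 : ℝ) * k)) * |X i k t| ≤ M) →
      (∀ i k, Continuous (X i k)) →
      (∀ i k, ∀ t ∈ Set.Icc (0 : ℝ) s, HasDerivWithinAt (X i k)
        (quadTerm ε₀ α X i k t - ν * (1 + ε₀) ^ ((2 : ℝ) * k) * X i k t) (Set.Icc 0 s) t) →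
      ∀ n N : ℕ, n ≤ N → ∀ t ∈ Set.Icc (0 : ℝ) s,
        ∑ k ∈ Finset.Icc n N, ∑ i ∈ S, (1 / 2) * X i (k : ℤ) t ^ 2 ≤
          C * (1 + ε₀) ^ (-((1 + η) * (n : ℝ))) := by
  intro R _hR ε₀ hε hε1 α hsc hα hK _hdiag
  have hε0 : 0 < ε₀ := by linarith
  have hceil : CeilingAt R ε₀ α :=
    subOnsagerCeiling_ceilingAt_of_shellBarrierAt hε0 (dyadicRange_shellBarrierAt R ε₀ hε hε1 α hsc)
  obtain ⟨η, hη, C, _hC0, H⟩ := viscousTailEnvelopeOrthant_uniform_of_ceilingAt hε0 hα hK hceil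
  refine ⟨Finset.univ, fun i hi => absurd (Finset.mem_univ i) hi, fun X₀ =>
    ⟨η, hη, fun T _hT => ⟨C * (∑ i : Fin 4, (1 / 2 : ℝ) * X₀ i ^ 2),
      fun ν hν s hs X hinit hlow hbd hcont hder n N hnN t ht => ?_⟩⟩⟩
  exact H ν hν X₀ s hs.1 X hinit hlow hbd hcont hder n N hnN t ht

end Summit.NavierStokesRegularity.NavierStokesRegularity.Theorems

end
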